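import Literature.NumberTheory.ConnesConsani2024.SemilocalTransformGeneralS
import Literature.NumberTheory.ConnesConsani2021.SoninProjection
import Literature.NumberTheory.ConnesConsani2021.SoninTraceReduction
import HarnessLib

/-!
# Connes–Consani–Moscovici 2024, §4.6–§4.7: the semilocal Sonin space for a general finite `S ∋ ∞` (Def. 4.5, Prop. 4.6 (i), Thm. 4.6)

RH-FREE corpus literature (label, l.1): A. Connes, C. Consani, H. Moscovici, *Zeta zeros and prolate wave
operators*, Ann. Funct. Anal. 15 (2024) = arXiv:2310.18423v2 [bib: `ConnesConsaniMoscovici2024`], §4.6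
"Semilocal Sonin spaces" (Def. 4.5, the Lemma = Prop. 4.6), §4.7 "The stability of Sonin spaces" and §4.8 (Thm. 4.6:
"Let `S` be a finite set of places with `∞ ∈ S` and `λ > 0`. Then the map `θ_S` induces a hilbertian isomorphism of
the Sonin spaces `θ_S : 𝒮_λ(ℝ, e_∞) → 𝒮_λ(X_S, α)`", printed for GENERAL finite `S`, arXiv chunk p0005:L25 /
p0015:L80–L95).  NO positivity statement; nothing here bears on the truth of RH.  WHAT THIS IS NOT: a construction
of `L²(X_S)`; any claim about Weil positivity on the semilocal Sonin space (none is in print).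

Cell `rh-crit`, corpus C1, row t13 g5.  The tree typed Def. 4.5 / Thm. 4.6 for `S = {∞, p}` only
(`ConnesConsani2021.semilocalSoninSpace p α β`, `mem_semilocalSoninSpace_iff_vanish`, `SemilocalSoninSpace.lean`).
This file is the printed generality `S = {∞} ∪ P`, `P` any finite set of primes, over `Connes2026.twistProd P`
(`θ_S`), `Connes2026.semilocalFourierOf P` (`𝔽_S`) and the general-`S` toolkit of
`SemilocalTransformGeneralS.lean`; the single-prime lemmas (`one_sub_primeTwist_mem_vanishOn`,
`one_sub_primeTwist_mem_evenPart`, `primeTwist_mem_of_mem`, `primeTwistEquiv_symm_mem`) are CITED factorwise.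

What is typed (P = proved, D = definition): `twistInvAt`/`twistInvProd` (`θ_S⁻¹ = Π_p θ_p⁻¹`) D with
`coe_twistProdUnit_inv : ↑(twistProdUnit P)⁻¹ = twistInvProd P` P, `twistProdEquiv` (`θ_S` bicontinuous) D;
**Def. 4.5 general `S`** `semilocalSoninSpaceOf P α β := θ_S(S(α, β))` D (`_empty = soninSpace`, `_singleton =
semilocalSoninSpace p` P); **Prop. 4.6 (i)** `twistProd_mem_semilocalSoninSpaceOf` P; **Thm. 4.6 general `S`**:
`twistProdSoninEquiv : soninSpace α β ≃L[ℂ] semilocalSoninSpaceOf P α β` D (the "hilbertian isomorphism"),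
`isClosed_semilocalSoninSpaceOf` P, and **Def. 4.5 ⟺ image definition** `mem_semilocalSoninSpaceOf_iff_vanish`
(`ξ` even, `ξ = 0` on `[−α, α]`, `𝔽_S ξ = 0` on `[−β, β]`) P; the orthogonal projection
`semilocalSoninProjectionOf` D (`_mem`, `_eq_self_iff` P).  **§4.8 general `S`** ("the choice of the finite set `S`
plays a key role in fixing the inner product"): `inner_twistProd_twistProd` (Gram operator `θ_S^*θ_S = η_S⁻¹θ_S`) P,
`twistKernelAt`/`twistKernelList`/`twistKernelProd` (`T_S k`, the successive 3-point twists; `_singleton = twistKernel p`)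
D, `soninTraceForm_twistProd` (`⟨θ_Sξ|ϑ(k)θ_Sξ⟩ = ⟨ξ|ϑ(T_S k)ξ⟩`) P, `semilocal_weakTrace_iff_of` (weak-trace bounds
over `𝔖_S(α,β)` ⟺ twisted archimedean bounds over `S(α,β)`; the tree's `semilocal_weakTrace_iff` is `S = {∞,p}`) P.
**Prop. 4.2 (ii) "the grading is given by the Fourier transform `𝔽_S`"** (appended): `𝔽_S` preserves
`L²(ℝ)_ev` and is an involution there — `twistProd_mem_evenPart`, `twistInvProd_mem_evenPart`,
`semilocalFourierOf_mem_evenPart`, **`semilocalFourierOf_semilocalFourierOf_of_mem_evenPart`** (`𝔽_S𝔽_Sξ = ξ`),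
`semilocalFourierInvOf_eq_of_mem_evenPart` (`𝔽_S⁻¹ = 𝔽_S = 𝔽_S^*` on even vectors; with `semilocalFourierOf_mem_unitary`
this is the unitary self-adjoint grading of the even cyclic pair) P.
No named fact; no instance, notation or attribute.

## References

* A. Connes, C. Consani, H. Moscovici, *Zeta zeros and prolate wave operators*, Ann. Funct. Anal. 15 (2024) 87,
  arXiv:2310.18423v2, §4.6 Def. 4.5, Lemma (= Prop. 4.6); §4.7 Thm. 4.6. [ConnesConsaniMoscovici2024]
-/

noncomputable section

open _root_.MeasureTheory Complex Set Filter FourierTransform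
open scoped Real ComplexConjugate ENNReal InnerProductSpace Topology

namespace Literature.NumberTheory.ConnesConsani2024

open Literature.NumberTheory.LFunctions Literature.Analysis.OperatorTheory
open Literature.NumberTheory.ConnesConsani2021 Literature.NumberTheory.Connes2026

/-! ## `θ_S⁻¹ = Π_p θ_p⁻¹` as an explicit product and `θ_S` as a bicontinuous isomorphism -/

section TwistInv

/-- `θ⁻¹` at one natural number: `θ_p⁻¹` (`(primeTwistEquiv p).symm`) if `p` is prime, the identity otherwise.
[cite: ConnesConsaniMoscovici2024, Thm. 4.6 §4.7 p. 22 (arXiv chunk p0015:L80–L95)] -/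
def twistInvAt (n : ℕ) : Lp ℂ 2 (volume : Measure ℝ) →L[ℂ] Lp ℂ 2 (volume : Measure ℝ) :=
  if h : n.Prime then
    ((@primeTwistEquiv n ⟨h⟩).symm : Lp ℂ 2 (volume : Measure ℝ) →L[ℂ] Lp ℂ 2 (volume : Measure ℝ))
  else 1

/-- For a prime, `twistInvAt p = θ_p⁻¹`. [cite: ConnesConsaniMoscovici2024, Thm. 4.6 §4.7 p. 22] -/
theorem twistInvAt_of_prime (q : ℕ) [hq : Fact q.Prime] :
    twistInvAt q =
      ((primeTwistEquiv q).symm : Lp ℂ 2 (volume : Measure ℝ) →L[ℂ] Lp ℂ 2 (volume : Measure ℝ)) := by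
  rw [twistInvAt, dif_pos hq.out]

/-- For a non-prime, `twistInvAt n = 1` (`θ_S` is the product over the PRIMES of `S`). [cite: ConnesConsaniMoscovici2024, §4.6 Lemma after Def. 4.5 (ii) p. 22 (arXiv chunk p0014:L89–L93)] -/
theorem twistInvAt_of_not_prime {n : ℕ} (hn : ¬ n.Prime) : twistInvAt n = 1 := by
  rw [twistInvAt, dif_neg hn]

/-- `θ_p⁻¹ θ_p = 1` factorwise. [cite: ConnesConsaniMoscovici2024, Thm. 4.6 §4.7 p. 22] -/
theorem twistInvAt_mul_twistAt (n : ℕ) : twistInvAt n * twistAt n = 1 := by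
  by_cases hn : n.Prime
  · haveI : Fact n.Prime := ⟨hn⟩
    rw [twistInvAt_of_prime, twistAt_of_prime]
    ext ξ : 1
    change (primeTwistEquiv n).symm (primeTwist n ξ) = ξ
    rw [← primeTwistEquiv_apply, ContinuousLinearEquiv.symm_apply_apply]
  · rw [twistInvAt_of_not_prime hn, twistAt_of_not_prime hn, mul_one]

/-- `θ_p θ_p⁻¹ = 1` factorwise. [cite: ConnesConsaniMoscovici2024, Thm. 4.6 §4.7 p. 22] -/
theorem twistAt_mul_twistInvAt (n : ℕ) : twistAt n * twistInvAt n = 1 := by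
  by_cases hn : n.Prime
  · haveI : Fact n.Prime := ⟨hn⟩
    rw [twistInvAt_of_prime, twistAt_of_prime]
    ext ξ : 1
    change primeTwist n ((primeTwistEquiv n).symm ξ) = ξ
    rw [← primeTwistEquiv_apply, ContinuousLinearEquiv.apply_symm_apply]
  · rw [twistInvAt_of_not_prime hn, twistAt_of_not_prime hn, mul_one]

/-- `twistInvAt m` and `twistAt n` commute (an operator commuting with `θ_m` commutes with `θ_m⁻¹`).
[cite: ConnesConsaniMoscovici2024, §4.6 Lemma after Def. 4.5 (ii) p. 22] -/
theorem commute_twistInvAt_twistAt (m n : ℕ) : Commute (twistInvAt m) (twistAt n) := by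
  by_cases hm : m.Prime
  · haveI : Fact m.Prime := ⟨hm⟩
    have hu : twistInvAt m = ((primeTwistUnit m)⁻¹ :
        (Lp ℂ 2 (volume : Measure ℝ) →L[ℂ] Lp ℂ 2 (volume : Measure ℝ))ˣ) := by
      rw [twistInvAt_of_prime]; rfl
    rw [hu]
    have h : Commute (twistAt n) ((primeTwistUnit m : (Lp ℂ 2 (volume : Measure ℝ) →L[ℂ]
        Lp ℂ 2 (volume : Measure ℝ))ˣ) : Lp ℂ 2 (volume : Measure ℝ) →L[ℂ] Lp ℂ 2 (volume : Measure ℝ)) := by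
      rw [val_primeTwistUnit, ← twistAt_of_prime]
      exact commute_twistAt_twistAt n m
    exact h.units_inv_right.symm
  · rw [twistInvAt_of_not_prime hm]
    exact Commute.one_left _

/-- `twistInvAt m` and `twistInvAt n` commute. [cite: ConnesConsaniMoscovici2024, §4.6 Lemma after Def. 4.5 (ii) p. 22] -/
theorem commute_twistInvAt_twistInvAt (m n : ℕ) : Commute (twistInvAt m) (twistInvAt n) := by
  by_cases hn : n.Prime
  · haveI : Fact n.Prime := ⟨hn⟩
    have hu : twistInvAt n = ((primeTwistUnit n)⁻¹ :
        (Lp ℂ 2 (volume : Measure ℝ) →L[ℂ] Lp ℂ 2 (volume : Measure ℝ))ˣ) := by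
      rw [twistInvAt_of_prime]; rfl
    rw [hu]
    have h : Commute (twistInvAt m) ((primeTwistUnit n : (Lp ℂ 2 (volume : Measure ℝ) →L[ℂ]
        Lp ℂ 2 (volume : Measure ℝ))ˣ) : Lp ℂ 2 (volume : Measure ℝ) →L[ℂ] Lp ℂ 2 (volume : Measure ℝ)) := by
      rw [val_primeTwistUnit, ← twistAt_of_prime]
      exact commute_twistInvAt_twistAt m n
    exact h.units_inv_right
  · rw [twistInvAt_of_not_prime hn]
    exact Commute.one_right _

/-- **`θ_S⁻¹ := Π_{p ∈ P} θ_p⁻¹`** along the increasing enumeration of `P` (mirror of `twistProd`). [cite: ConnesConsaniMoscovici2024, Thm. 4.6 §4.7 p. 22 (arXiv chunk p0015:L80–L95)] -/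
def twistInvProd (P : Finset ℕ) : Lp ℂ 2 (volume : Measure ℝ) →L[ℂ] Lp ℂ 2 (volume : Measure ℝ) :=
  ((P.sort (· ≤ ·)).map twistInvAt).prod

/-- `θ_S⁻¹` as a `Finset.noncommProd`. [cite: ConnesConsaniMoscovici2024, Thm. 4.6 §4.7 p. 22] -/
theorem twistInvProd_eq_noncommProd (P : Finset ℕ) :
    twistInvProd P = P.noncommProd twistInvAt (fun a _ b _ _ => commute_twistInvAt_twistInvAt a b) := by
  have h := Finset.noncommProd_toFinset (α := ℕ) (P.sort (· ≤ ·)) twistInvAt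
    (fun a _ b _ _ => commute_twistInvAt_twistInvAt a b) (Finset.sort_nodup _ _)
  rw [twistInvProd, ← h]
  exact Finset.noncommProd_congr (Finset.sort_toFinset _ _) (fun _ _ => rfl) _

/-- `θ⁻¹_{S ∪ {a}} = θ_a⁻¹ θ_S⁻¹` for `a ∉ P`. [cite: ConnesConsaniMoscovici2024, Thm. 4.6 §4.7 p. 22] -/
theorem twistInvProd_insert {a : ℕ} {P : Finset ℕ} (ha : a ∉ P) :
    twistInvProd (insert a P) = twistInvAt a * twistInvProd P := by
  rw [twistInvProd_eq_noncommProd, twistInvProd_eq_noncommProd, Finset.noncommProd_insert_of_notMem _ _ _ _ ha]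

/-- `θ_∅⁻¹ = 1`. [cite: ConnesConsaniMoscovici2024, Thm. 4.6 §4.7 p. 22] -/
theorem twistInvProd_empty : twistInvProd ∅ = 1 := by simp [twistInvProd]

/-- `θ_S⁻¹ θ_S = 1`. [cite: ConnesConsaniMoscovici2024, Thm. 4.6 §4.7 p. 22 (arXiv chunk p0015:L88)] -/
theorem twistInvProd_mul_twistProd (P : Finset ℕ) : twistInvProd P * twistProd P = 1 := by
  induction P using Finset.induction_on with
  | empty => simp [twistInvProd_empty, twistProd_empty]
  | insert a P ha ih =>
    rw [twistProd_insert ha, twistInvProd_insert ha]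
    have hc : Commute (twistInvProd P) (twistAt a) := Commute.list_prod_left _ _ fun x hx => by
      obtain ⟨n, -, rfl⟩ := List.mem_map.mp hx
      exact commute_twistInvAt_twistAt n a
    calc twistInvAt a * twistInvProd P * (twistAt a * twistProd P)
        = twistInvAt a * (twistInvProd P * twistAt a) * twistProd P := by simp only [mul_assoc]
      _ = twistInvAt a * (twistAt a * twistInvProd P) * twistProd P := by rw [hc.eq]
      _ = (twistInvAt a * twistAt a) * (twistInvProd P * twistProd P) := by simp only [mul_assoc]
      _ = 1 := by rw [ih, twistInvAt_mul_twistAt, mul_one]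

/-- `θ_S θ_S⁻¹ = 1`. [cite: ConnesConsaniMoscovici2024, Thm. 4.6 §4.7 p. 22 (arXiv chunk p0015:L88)] -/
theorem twistProd_mul_twistInvProd (P : Finset ℕ) : twistProd P * twistInvProd P = 1 := by
  induction P using Finset.induction_on with
  | empty => simp [twistInvProd_empty, twistProd_empty]
  | insert a P ha ih =>
    rw [twistProd_insert ha, twistInvProd_insert ha]
    have hc : Commute (twistProd P) (twistInvAt a) := Commute.list_prod_left _ _ fun x hx => by
      obtain ⟨n, -, rfl⟩ := List.mem_map.mp hx
      exact (commute_twistInvAt_twistAt a n).symm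
    calc twistAt a * twistProd P * (twistInvAt a * twistInvProd P)
        = twistAt a * (twistProd P * twistInvAt a) * twistInvProd P := by simp only [mul_assoc]
      _ = twistAt a * (twistInvAt a * twistProd P) * twistInvProd P := by rw [hc.eq]
      _ = (twistAt a * twistInvAt a) * (twistProd P * twistInvProd P) := by simp only [mul_assoc]
      _ = 1 := by rw [ih, twistAt_mul_twistInvAt, mul_one]

/-- **`θ_S⁻¹` (the inverse of the unit `twistProdUnit P`) IS the product `Π_p θ_p⁻¹`.** [cite: ConnesConsaniMoscovici2024, Thm. 4.6 §4.7 p. 22] -/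
theorem coe_twistProdUnit_inv (P : Finset ℕ) :
    (↑(twistProdUnit P)⁻¹ : Lp ℂ 2 (volume : Measure ℝ) →L[ℂ] Lp ℂ 2 (volume : Measure ℝ)) = twistInvProd P := by
  apply Units.inv_eq_of_mul_eq_one_right
  rw [val_twistProdUnit, twistProd_mul_twistInvProd]

/-- **`θ_S` is a bicontinuous linear isomorphism of `L²(ℝ)`** (the first step of the proof of Thm. 4.6: "the map
`θ_S … L²(ℝ)^{ev} → L²(X_S)^{K_S}` is bounded with bounded inverse"). [cite: ConnesConsaniMoscovici2024, proof of Thm. 4.6 §4.7 p. 23 (arXiv chunk p0015:L84–L90)] -/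
def twistProdEquiv (P : Finset ℕ) : Lp ℂ 2 (volume : Measure ℝ) ≃L[ℂ] Lp ℂ 2 (volume : Measure ℝ) :=
  ContinuousLinearEquiv.ofUnit (twistProdUnit P)

/-- `twistProdEquiv` acts as `θ_S`. [cite: ConnesConsaniMoscovici2024, Thm. 4.6 §4.7 p. 22] -/
theorem twistProdEquiv_apply (P : Finset ℕ) (ξ : Lp ℂ 2 (volume : Measure ℝ)) :
    twistProdEquiv P ξ = twistProd P ξ := rfl

/-- `twistProdEquiv⁻¹` acts as `θ_S⁻¹ = Π_p θ_p⁻¹`. [cite: ConnesConsaniMoscovici2024, Thm. 4.6 §4.7 p. 22] -/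
theorem twistProdEquiv_symm_apply (P : Finset ℕ) (ξ : Lp ℂ 2 (volume : Measure ℝ)) :
    (twistProdEquiv P).symm ξ = twistInvProd P ξ := by
  rw [← coe_twistProdUnit_inv]
  rfl

/-- `𝔽_S ξ = θ_S (𝓕 (θ_S⁻¹ ξ))` with the explicit inverse. [cite: ConnesConsaniMoscovici2024, Prop. 4.7 (i) §4.7 p. 22 (arXiv chunk p0015:L42)] -/
theorem semilocalFourierOf_apply (P : Finset ℕ) (ξ : Lp ℂ 2 (volume : Measure ℝ)) :
    semilocalFourierOf P ξ = twistProd P ((𝓕 (twistInvProd P ξ) : Lp ℂ 2 (volume : Measure ℝ))) := by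
  rw [← coe_twistProdUnit_inv]
  rfl

/-- `θ_S` preserves every submodule preserved by all the `1 − θ_p`. [cite: ConnesConsaniMoscovici2024, Thm. 4.6 §4.7 p. 22] -/
theorem twistProd_mem_of_mem {V : Submodule ℂ (Lp ℂ 2 (volume : Measure ℝ))}
    (hV : ∀ (q : ℕ) (hq : q.Prime), ∀ ξ ∈ V,
      ((1 : Lp ℂ 2 (volume : Measure ℝ) →L[ℂ] Lp ℂ 2 (volume : Measure ℝ)) - @primeTwist q ⟨hq⟩) ξ ∈ V)
    (P : Finset ℕ) {ξ : Lp ℂ 2 (volume : Measure ℝ)} (hξ : ξ ∈ V) : twistProd P ξ ∈ V := by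
  unfold twistProd
  suffices h : ∀ l : List ℕ, (l.map twistAt).prod ξ ∈ V from h _
  intro l
  induction l with
  | nil => simpa using hξ
  | cons a l ih =>
    rw [List.map_cons, List.prod_cons]
    change twistAt a ((l.map twistAt).prod ξ) ∈ V
    by_cases ha : a.Prime
    · haveI : Fact a.Prime := ⟨ha⟩
      rw [twistAt_of_prime]
      exact primeTwist_mem_of_mem a (hV a ha) ih
    · rw [twistAt_of_not_prime ha]
      exact ih

/-- `θ_S⁻¹` preserves every CLOSED submodule preserved by all the `1 − θ_p` (Neumann series factorwise).
[cite: ConnesConsaniMoscovici2024, Thm. 4.6 §4.7 p. 22 (arXiv chunk p0015:L88)] -/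
theorem twistInvProd_mem_of_mem {V : Submodule ℂ (Lp ℂ 2 (volume : Measure ℝ))}
    (hVc : IsClosed (V : Set (Lp ℂ 2 (volume : Measure ℝ))))
    (hV : ∀ (q : ℕ) (hq : q.Prime), ∀ ξ ∈ V,
      ((1 : Lp ℂ 2 (volume : Measure ℝ) →L[ℂ] Lp ℂ 2 (volume : Measure ℝ)) - @primeTwist q ⟨hq⟩) ξ ∈ V)
    (P : Finset ℕ) {ξ : Lp ℂ 2 (volume : Measure ℝ)} (hξ : ξ ∈ V) : twistInvProd P ξ ∈ V := by
  unfold twistInvProd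
  suffices h : ∀ l : List ℕ, (l.map twistInvAt).prod ξ ∈ V from h _
  intro l
  induction l with
  | nil => simpa using hξ
  | cons a l ih =>
    rw [List.map_cons, List.prod_cons]
    change twistInvAt a ((l.map twistInvAt).prod ξ) ∈ V
    by_cases ha : a.Prime
    · haveI : Fact a.Prime := ⟨ha⟩
      rw [twistInvAt_of_prime]
      exact primeTwistEquiv_symm_mem a hVc (hV a ha) ih
    · rw [twistInvAt_of_not_prime ha]
      exact ih

end TwistInv

/-! ## Definition 4.5 / Prop. 4.6 (i) / Theorem 4.6 for a general finite `S ∋ ∞` -/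

section Sonin

/-- **The semilocal Sonin space `𝔖_S(α, β)` for a general finite `S = {∞} ∪ P`** (CCM 2024 Def. 4.5:
"`𝒮_λ(X_S, α) := {f ∈ L²(X_S) | f(x) = 0 & 𝔽_α f(x) = 0 ∀ |x| < λ}`", `K_S`-invariant part), pulled back to
`L²(ℝ)_ev`: by Thm. 4.6 ("`θ_S` induces a hilbertian isomorphism `𝒮_λ(ℝ, e_∞) → 𝒮_λ(X_S, α)`") it is the image of
Sonin's space `S(α, β)` under `θ_S = twistProd P`, which is taken as the definition (radii `α`, `β` kept separate as
in the tree's `soninSpace α β`; Def. 4.5 has `α = β = λ`); the intrinsic description is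
`mem_semilocalSoninSpaceOf_iff_vanish`.  For `P = {p}` this is `ConnesConsani2021.semilocalSoninSpace p α β`.
[cite: ConnesConsaniMoscovici2024, Def. 4.5 §4.6 p. 21 (arXiv chunk p0014:L78–L84); Thm. 4.6 §4.7 p. 22 (chunk p0015:L80)] -/
def semilocalSoninSpaceOf (P : Finset ℕ) (α β : ℝ) : Submodule ℂ (Lp ℂ 2 (volume : Measure ℝ)) :=
  (soninSpace α β).map (twistProd P).toLinearMap

/-- Membership: `ξ ∈ 𝔖_S(α, β)` iff `ξ = θ_S η` for some `η ∈ S(α, β)`. [cite: ConnesConsaniMoscovici2024, Thm. 4.6 §4.7 p. 22] -/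
theorem mem_semilocalSoninSpaceOf_iff {P : Finset ℕ} {α β : ℝ} {ξ : Lp ℂ 2 (volume : Measure ℝ)} :
    ξ ∈ semilocalSoninSpaceOf P α β ↔ ∃ η ∈ soninSpace α β, twistProd P η = ξ :=
  Submodule.mem_map

/-- `S = {∞}`: `𝔖_∅(α, β) = S(α, β)`. [cite: ConnesConsaniMoscovici2024, Def. 4.5 §4.6 p. 21] -/
theorem semilocalSoninSpaceOf_empty (α β : ℝ) : semilocalSoninSpaceOf ∅ α β = soninSpace α β := by
  rw [semilocalSoninSpaceOf, twistProd_empty]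
  exact Submodule.map_id _

/-- `S = {∞, p}`: agreement with `ConnesConsani2021.semilocalSoninSpace p`. [cite: ConnesConsaniMoscovici2024, Def. 4.5 §4.6 p. 21] -/
theorem semilocalSoninSpaceOf_singleton (q : ℕ) [Fact q.Prime] (α β : ℝ) :
    semilocalSoninSpaceOf {q} α β = semilocalSoninSpace q α β := by
  rw [semilocalSoninSpaceOf, twistProd_singleton]
  rfl

/-- **Prop. 4.6 (i) for a general finite `S`** ("Let `f ∈ 𝒮_λ(ℝ, e_∞)`, `θ_S(f)` the class of `σ_S ⊗ f` in
`L²(X_S)`. Then `θ_S(f)` belongs to `𝒮_λ(X_S, α)`"): `θ_S` maps `S(α, β)` into `𝔖_S(α, β)` (here by definition;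
the content is `mem_semilocalSoninSpaceOf_iff_vanish`). [cite: ConnesConsaniMoscovici2024, §4.6 Lemma (Prop. 4.6) (i) p. 21 (arXiv chunk p0014:L86–L87)] -/
theorem twistProd_mem_semilocalSoninSpaceOf (P : Finset ℕ) {α β : ℝ} {η : Lp ℂ 2 (volume : Measure ℝ)}
    (hη : η ∈ soninSpace α β) : twistProd P η ∈ semilocalSoninSpaceOf P α β :=
  Submodule.mem_map_of_mem hη

/-- **Theorem 4.6 for a general finite `S ∋ ∞`**: "the map `θ_S` induces a hilbertian isomorphism of the Sonin
spaces `θ_S : 𝒮_λ(ℝ, e_∞) → 𝒮_λ(X_S, α)`" — pulled back: `θ_S` restricts to a bicontinuous linear isomorphism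
`S(α, β) ≃ 𝔖_S(α, β)` ("hilbertian isomorphism" = isomorphism of Hilbert spaces, not an isometry: `θ_S` is bounded
with bounded inverse).  PROVED (restriction of `twistProdEquiv`).  RH-FREE.
[cite: ConnesConsaniMoscovici2024, Thm. 4.6 §4.7 p. 22 (arXiv chunk p0015:L80–L95)] -/
def twistProdSoninEquiv (P : Finset ℕ) (α β : ℝ) : soninSpace α β ≃L[ℂ] semilocalSoninSpaceOf P α β :=
  (twistProdEquiv P).submoduleMap (soninSpace α β)

/-- The isomorphism of Thm. 4.6 acts as `θ_S`. [cite: ConnesConsaniMoscovici2024, Thm. 4.6 §4.7 p. 22] -/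
theorem coe_twistProdSoninEquiv_apply (P : Finset ℕ) {α β : ℝ} (η : soninSpace α β) :
    ((twistProdSoninEquiv P α β η : semilocalSoninSpaceOf P α β) : Lp ℂ 2 (volume : Measure ℝ)) =
      twistProd P η :=
  rfl

/-- **The semilocal Sonin space is closed** (image of the closed `S(α, β)` under the isomorphism `θ_S`; Thm. 4.6).
[cite: ConnesConsaniMoscovici2024, Thm. 4.6 §4.7 p. 22] -/
theorem isClosed_semilocalSoninSpaceOf (P : Finset ℕ) (α β : ℝ) :
    IsClosed (semilocalSoninSpaceOf P α β : Set (Lp ℂ 2 (volume : Measure ℝ))) := by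
  have hset : (semilocalSoninSpaceOf P α β : Set (Lp ℂ 2 (volume : Measure ℝ))) =
      twistProdEquiv P '' (soninSpace α β : Set (Lp ℂ 2 (volume : Measure ℝ))) := by
    ext ξ
    simp only [semilocalSoninSpaceOf, Submodule.map_coe, Set.mem_image, SetLike.mem_coe,
      ContinuousLinearMap.coe_coe, twistProdEquiv_apply]
  rw [hset, ContinuousLinearEquiv.isClosed_image]
  exact isClosed_soninSpace α β

/-- **CCM 2024 Definition 4.5 = the image definition (Theorem 4.6 pulled back), general finite `S`, PROVED**:
`ξ ∈ 𝔖_S(α, β)` iff `ξ` is a.e. even, `ξ = 0` a.e. on `[−α, α]` and `𝔽_S ξ = 0` a.e. on `[−β, β]`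
(`𝔽_S = semilocalFourierOf P`).  Factorwise from the single-prime facts "`1 − θ_p` preserves evenness and the
vanishing on `[−γ, γ]`", `θ_p⁻¹ = Σ_k (1 − θ_p)^k`, and `𝔽_S θ_S = θ_S 𝓕`.  RH-FREE.
[cite: ConnesConsaniMoscovici2024, Def. 4.5 §4.6 p. 21 (arXiv chunk p0014:L78–L84); Thm. 4.6 §4.7 p. 22 (chunk p0015:L80–L95)] -/
theorem mem_semilocalSoninSpaceOf_iff_vanish {P : Finset ℕ} {α β : ℝ} {ξ : Lp ℂ 2 (volume : Measure ℝ)} :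
    ξ ∈ semilocalSoninSpaceOf P α β ↔
      (∀ᵐ x : ℝ, (ξ : ℝ → ℂ) (-x) = (ξ : ℝ → ℂ) x) ∧
      (∀ᵐ x : ℝ, x ∈ Icc (-α) α → (ξ : ℝ → ℂ) x = 0) ∧
      (∀ᵐ x : ℝ, x ∈ Icc (-β) β →
        ((semilocalFourierOf P ξ : Lp ℂ 2 (volume : Measure ℝ)) : ℝ → ℂ) x = 0) := by
  have hVe : ∀ (q : ℕ) (hq : q.Prime), ∀ ξ ∈ evenPart,
      ((1 : Lp ℂ 2 (volume : Measure ℝ) →L[ℂ] Lp ℂ 2 (volume : Measure ℝ)) - @primeTwist q ⟨hq⟩) ξ ∈ evenPart :=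
    fun q hq ξ h => @one_sub_primeTwist_mem_evenPart q ⟨hq⟩ ξ h
  have hVa : ∀ γ : ℝ, ∀ (q : ℕ) (hq : q.Prime), ∀ ξ ∈ vanishOn γ,
      ((1 : Lp ℂ 2 (volume : Measure ℝ) →L[ℂ] Lp ℂ 2 (volume : Measure ℝ)) - @primeTwist q ⟨hq⟩) ξ ∈ vanishOn γ :=
    fun γ q hq ξ h => @one_sub_primeTwist_mem_vanishOn q ⟨hq⟩ γ ξ h
  set η := twistInvProd P ξ with hη
  have hξη : twistProd P η = ξ :=
    congrArg (fun T : Lp ℂ 2 (volume : Measure ℝ) →L[ℂ] Lp ℂ 2 (volume : Measure ℝ) => T ξ)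
      (twistProd_mul_twistInvProd P)
  have hF : semilocalFourierOf P ξ = twistProd P ((𝓕 η : Lp ℂ 2 (volume : Measure ℝ))) :=
    semilocalFourierOf_apply P ξ
  change ξ ∈ semilocalSoninSpaceOf P α β ↔
    ξ ∈ evenPart ∧ ξ ∈ vanishOn α ∧ semilocalFourierOf P ξ ∈ vanishOn β
  constructor
  · intro h
    obtain ⟨η', hη'S, hη'eq⟩ := mem_semilocalSoninSpaceOf_iff.1 h
    have hηη' : η' = η := by
      have h1 : twistInvProd P (twistProd P η') = η' :=
        congrArg (fun T : Lp ℂ 2 (volume : Measure ℝ) →L[ℂ] Lp ℂ 2 (volume : Measure ℝ) => T η')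
          (twistInvProd_mul_twistProd P)
      rw [← h1, hη'eq]
    rw [hηη'] at hη'S
    obtain ⟨he, hv, hf⟩ := (mem_soninSpace_iff' ).1 hη'S
    refine ⟨?_, ?_, ?_⟩
    · rw [← hξη]; exact twistProd_mem_of_mem hVe P he
    · rw [← hξη]; exact twistProd_mem_of_mem (hVa α) P hv
    · rw [hF]; exact twistProd_mem_of_mem (hVa β) P hf
  · rintro ⟨he, hv, hf⟩
    refine mem_semilocalSoninSpaceOf_iff.2 ⟨η, ?_, hξη⟩
    refine (mem_soninSpace_iff' ).2 ⟨?_, ?_, ?_⟩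
    · exact twistInvProd_mem_of_mem isClosed_evenPart hVe P he
    · exact twistInvProd_mem_of_mem (isClosed_vanishOn α) (hVa α) P hv
    · have : (𝓕 η : Lp ℂ 2 (volume : Measure ℝ)) = twistInvProd P (semilocalFourierOf P ξ) := by
        have h1 : twistInvProd P (twistProd P (𝓕 η : Lp ℂ 2 (volume : Measure ℝ))) =
            (𝓕 η : Lp ℂ 2 (volume : Measure ℝ)) :=
          congrArg (fun T : Lp ℂ 2 (volume : Measure ℝ) →L[ℂ] Lp ℂ 2 (volume : Measure ℝ) =>
            T (𝓕 η : Lp ℂ 2 (volume : Measure ℝ))) (twistInvProd_mul_twistProd P)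
        rw [hF, h1]
      rw [this]
      exact twistInvProd_mem_of_mem (isClosed_vanishOn β) (hVa β) P hf

/-- Every `ξ ∈ 𝔖_S(α, β)` vanishes a.e. on `[−α, α]` (the position half of Def. 4.5). [cite: ConnesConsaniMoscovici2024, Def. 4.5 §4.6 p. 21 (arXiv chunk p0014:L80)] -/
theorem ae_eq_zero_of_mem_semilocalSoninSpaceOf {P : Finset ℕ} {α β : ℝ} {ξ : Lp ℂ 2 (volume : Measure ℝ)}
    (hξ : ξ ∈ semilocalSoninSpaceOf P α β) :
    ∀ᵐ x : ℝ, x ∈ Icc (-α) α → (ξ : ℝ → ℂ) x = 0 :=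
  (mem_semilocalSoninSpaceOf_iff_vanish.1 hξ).2.1

/-- Every `ξ ∈ 𝔖_S(α, β)` has `𝔽_S ξ = 0` a.e. on `[−β, β]` (the Fourier half of Def. 4.5). [cite: ConnesConsaniMoscovici2024, Def. 4.5 §4.6 p. 21 (arXiv chunk p0014:L80)] -/
theorem semilocalFourierOf_ae_eq_zero_of_mem {P : Finset ℕ} {α β : ℝ} {ξ : Lp ℂ 2 (volume : Measure ℝ)}
    (hξ : ξ ∈ semilocalSoninSpaceOf P α β) :
    ∀ᵐ x : ℝ, x ∈ Icc (-β) β → ((semilocalFourierOf P ξ : Lp ℂ 2 (volume : Measure ℝ)) : ℝ → ℂ) x = 0 :=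
  (mem_semilocalSoninSpaceOf_iff_vanish.1 hξ).2.2

/-- **The orthogonal projection `𝔖_S` of `L²(ℝ)` onto the semilocal Sonin space** `𝔖_S(α, β)`, general finite
`S` (the space is closed, hence complete; the local instance is supplied inside the definition, none is declared).
[cite: ConnesConsaniMoscovici2024, Def. 4.5 §4.6 p. 21; Introduction p. 3] -/
def semilocalSoninProjectionOf (P : Finset ℕ) (α β : ℝ) :
    Lp ℂ 2 (volume : Measure ℝ) →L[ℂ] Lp ℂ 2 (volume : Measure ℝ) :=
  haveI : CompleteSpace (semilocalSoninSpaceOf P α β) := (isClosed_semilocalSoninSpaceOf P α β).completeSpace_coe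
  (semilocalSoninSpaceOf P α β).starProjection

/-- `𝔖_S ξ ∈ 𝔖_S(α, β)`. [cite: ConnesConsaniMoscovici2024, Def. 4.5 §4.6 p. 21] -/
theorem semilocalSoninProjectionOf_mem (P : Finset ℕ) (α β : ℝ) (ξ : Lp ℂ 2 (volume : Measure ℝ)) :
    semilocalSoninProjectionOf P α β ξ ∈ semilocalSoninSpaceOf P α β := by
  haveI : CompleteSpace (semilocalSoninSpaceOf P α β) := (isClosed_semilocalSoninSpaceOf P α β).completeSpace_coe
  exact Submodule.starProjection_apply_mem _ ξ

/-- `𝔖_S ξ = ξ ↔ ξ ∈ 𝔖_S(α, β)`. [cite: ConnesConsaniMoscovici2024, Def. 4.5 §4.6 p. 21] -/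
theorem semilocalSoninProjectionOf_eq_self_iff {P : Finset ℕ} {α β : ℝ} {ξ : Lp ℂ 2 (volume : Measure ℝ)} :
    semilocalSoninProjectionOf P α β ξ = ξ ↔ ξ ∈ semilocalSoninSpaceOf P α β := by
  haveI : CompleteSpace (semilocalSoninSpaceOf P α β) := (isClosed_semilocalSoninSpaceOf P α β).completeSpace_coe
  exact Submodule.starProjection_eq_self_iff

end Sonin

/-! ## §4.8 for a general finite `S`: the `S`-dependent inner product and the trace functional in archimedean terms

CCM 2024 §4.8 (p. 23): "the hilbertian structure of the Sonin spaces `𝔖_λ(X_S, α)` is independent of `S` … the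
choice of the finite set `S` plays a key role in fixing the inner product".  Quantitatively and for general
`S = {∞} ∪ P`: the Gram operator of `θ_S` is `θ_S^*θ_S = η_S⁻¹θ_S = Π_p (1 − D_p)θ_p` (`adjoint_twistProd`), and the
CC 2021 trace functional `⟨θ_Sξ | ϑ(k) θ_Sξ⟩` is the archimedean functional of `ξ` for the kernel twisted
successively by the single-prime 3-point twists `T_p` (`ConnesConsani2021.twistKernel`,
`soninTraceForm_primeTwist`), so that every weak-trace statement over `𝔖_S(α, β)` is a twisted archimedean
statement over `S(α, β)` (the tree's `semilocal_weakTrace_iff` for `S = {∞, p}`). -/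

section TwistedInnerProduct

/-- **The Gram form of `θ_S`, general `S`**: `⟪θ_S ζ, θ_S ζ'⟫ = ⟪ζ, (η_S⁻¹θ_S) ζ'⟫` — the `S`-dependent inner
product on the SAME space `S(α, β)` (§4.8), with Gram operator `θ_S^*θ_S = Π_p (1 − D_p)θ_p`.  PROVED.
[cite: ConnesConsaniMoscovici2024, §4.8 p. 23 (arXiv chunk p0015:L97–L104)] -/
theorem inner_twistProd_twistProd (P : Finset ℕ) (ζ ζ' : Lp ℂ 2 (volume : Measure ℝ)) :
    ⟪twistProd P ζ, twistProd P ζ'⟫_ℂ = ⟪ζ, (etaInvProd P * twistProd P) ζ'⟫_ℂ := by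
  rw [inner_twistProd_left]
  rfl

/-- The single-prime 3-point twist of a kernel at one natural number: `T_p k` (`ConnesConsani2021.twistKernel`) if
`p` is prime, `k` otherwise. [cite: ConnesConsaniMoscovici2024, §4.8 p. 23] -/
def twistKernelAt (n : ℕ) (k : ℝ → ℂ) : ℝ → ℂ :=
  if n.Prime then twistKernel n k else k

/-- For a prime, `twistKernelAt p = T_p`. [cite: ConnesConsaniMoscovici2024, §4.8 p. 23] -/
theorem twistKernelAt_of_prime (q : ℕ) [hq : Fact q.Prime] (k : ℝ → ℂ) : twistKernelAt q k = twistKernel q k := by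
  rw [twistKernelAt, if_pos hq.out]

/-- For a non-prime, `twistKernelAt n k = k`. [cite: ConnesConsaniMoscovici2024, §4.8 p. 23] -/
theorem twistKernelAt_of_not_prime {n : ℕ} (hn : ¬ n.Prime) (k : ℝ → ℂ) : twistKernelAt n k = k := by
  rw [twistKernelAt, if_neg hn]

/-- `T_p` preserves integrability of the kernel. [cite: ConnesConsaniMoscovici2024, §4.8 p. 23] -/
theorem integrable_twistKernel (q : ℕ) {k : ℝ → ℂ} (hk : Integrable k) :
    Integrable (twistKernel q k) := by
  have h : twistKernel q k = fun τ => (1 + (q : ℂ)⁻¹) * k τ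
      - (Real.exp (-(Real.log q / 2)) : ℂ) * (k (τ - Real.log q) + k (τ + Real.log q)) := rfl
  rw [h]
  exact (hk.const_mul _).sub (((hk.comp_sub_right _).add (hk.comp_add_right _)).const_mul _)

/-- `twistKernelAt n` preserves integrability. [cite: ConnesConsaniMoscovici2024, §4.8 p. 23] -/
theorem integrable_twistKernelAt (n : ℕ) {k : ℝ → ℂ} (hk : Integrable k) : Integrable (twistKernelAt n k) := by
  by_cases hn : n.Prime
  · haveI : Fact n.Prime := ⟨hn⟩
    rw [twistKernelAt_of_prime]
    exact integrable_twistKernel n hk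
  · rw [twistKernelAt_of_not_prime hn]
    exact hk

/-- The successive twist of a kernel along a list of natural numbers (head applied first). [cite: ConnesConsaniMoscovici2024, §4.8 p. 23] -/
def twistKernelList : List ℕ → (ℝ → ℂ) → (ℝ → ℂ)
  | [], k => k
  | a :: l, k => twistKernelList l (twistKernelAt a k)

/-- `twistKernelList` preserves integrability. [cite: ConnesConsaniMoscovici2024, §4.8 p. 23] -/
theorem integrable_twistKernelList {k : ℝ → ℂ} (l : List ℕ) (hk : Integrable k) :
    Integrable (twistKernelList l k) := by
  induction l generalizing k with
  | nil => exact hk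
  | cons a l ih => exact ih (integrable_twistKernelAt a hk)

/-- **The `S`-twisted kernel `T_S k`**: the single-prime 3-point twists `T_p` (`ConnesConsani2021.twistKernel`,
convolution by the measure `m_p = (1 + p⁻¹)δ₀ − p^{−1/2}(δ_{log p} + δ_{−log p})` of `θ_p^*θ_p`) applied successively
over the primes of `S` along the increasing enumeration (they commute); Mellin/Fourier symbol
`k̂(s)·Π_p |1 − p^{−1/2−is}|²`. [cite: ConnesConsaniMoscovici2024, §4.8 p. 23 (arXiv chunk p0015:L97–L104)] -/
def twistKernelProd (P : Finset ℕ) (k : ℝ → ℂ) : ℝ → ℂ :=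
  twistKernelList (P.sort (· ≤ ·)) k

/-- `T_S` preserves integrability. [cite: ConnesConsaniMoscovici2024, §4.8 p. 23] -/
theorem integrable_twistKernelProd (P : Finset ℕ) {k : ℝ → ℂ} (hk : Integrable k) :
    Integrable (twistKernelProd P k) :=
  integrable_twistKernelList _ hk

/-- `T_∅ k = k`. [cite: ConnesConsaniMoscovici2024, §4.8 p. 23] -/
theorem twistKernelProd_empty (k : ℝ → ℂ) : twistKernelProd ∅ k = k := by
  simp [twistKernelProd, twistKernelList]

/-- `T_{{p}} = T_p`: agreement with `ConnesConsani2021.twistKernel`. [cite: ConnesConsaniMoscovici2024, §4.8 p. 23] -/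
theorem twistKernelProd_singleton (q : ℕ) [Fact q.Prime] (k : ℝ → ℂ) :
    twistKernelProd {q} k = twistKernel q k := by
  simp [twistKernelProd, twistKernelList, twistKernelAt_of_prime]

/-- The trace functional under a list product of twists. [cite: ConnesConsaniMoscovici2024, §4.8 p. 23] -/
theorem soninTraceForm_list_prod_twistAt {k : ℝ → ℂ} (l : List ℕ) (hk : Integrable k)
    (ξ : Lp ℂ 2 (volume : Measure ℝ)) :
    soninTraceForm k (((l.map twistAt).prod ξ : Lp ℂ 2 (volume : Measure ℝ)) : ℝ → ℂ) =
      soninTraceForm (twistKernelList l k) (ξ : ℝ → ℂ) := by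
  induction l generalizing k with
  | nil => rfl
  | cons a l ih =>
    rw [List.map_cons, List.prod_cons]
    change soninTraceForm k ((twistAt a ((l.map twistAt).prod ξ) : Lp ℂ 2 (volume : Measure ℝ)) : ℝ → ℂ) =
      soninTraceForm (twistKernelList l (twistKernelAt a k)) (ξ : ℝ → ℂ)
    by_cases ha : a.Prime
    · haveI : Fact a.Prime := ⟨ha⟩
      rw [twistAt_of_prime, twistKernelAt_of_prime, soninTraceForm_primeTwist a hk]
      exact ih (integrable_twistKernel a hk)
    · rw [twistAt_of_not_prime ha, twistKernelAt_of_not_prime ha]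
      exact ih hk

/-- **The trace functional under `θ_S`, general `S`**: `⟨θ_Sξ | ϑ(k) θ_Sξ⟩ = ⟨ξ | ϑ(T_S k) ξ⟩` for `k ∈ L¹(ℝ)` —
the diagonal term of the semilocal Sonin trace at `θ_Sζ` is the archimedean diagonal term for the `S`-twisted
kernel at `ζ` (CCM 2024 §4.8's remark, quantified for every finite `S`).  PROVED (factorwise from
`soninTraceForm_primeTwist`).  RH-FREE. [cite: ConnesConsaniMoscovici2024, §4.8 p. 23 (arXiv chunk p0015:L97–L104)] -/
theorem soninTraceForm_twistProd (P : Finset ℕ) {k : ℝ → ℂ} (hk : Integrable k) (ξ : Lp ℂ 2 (volume : Measure ℝ)) :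
    soninTraceForm k ((twistProd P ξ : Lp ℂ 2 (volume : Measure ℝ)) : ℝ → ℂ) =
      soninTraceForm (twistKernelProd P k) (ξ : ℝ → ℂ) :=
  soninTraceForm_list_prod_twistAt _ hk ξ

/-- **Every semilocal weak-trace bound is a twisted archimedean bound, general finite `S`.**  For `k ∈ L¹(ℝ)`,
radii `α, β` and a constant `C`, the following are equivalent: (i) for every finite orthonormal family `ξ_i` of
`𝔖_S(α, β) = θ_S(S(α, β))`, `Σ_i Re⟨ξ_i | ϑ(k) ξ_i⟩ ≤ C`; (ii) for every finite family `ζ_i` of CC's archimedean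
Sonin space `S(α, β)` whose twists `θ_Sζ_i` are orthonormal (Gram operator `η_S⁻¹θ_S`, `inner_twistProd_twistProd`),
`Σ_i Re⟨ζ_i | ϑ(T_S k) ζ_i⟩ ≤ C`.  The primes of `S` enter only through the successive 3-point twists of the kernel
and of the Gram form (the tree's `semilocal_weakTrace_iff` is the case `S = {∞, p}`).  PROVED.  RH-FREE.
[cite: ConnesConsaniMoscovici2024, Thm. 4.6 §4.7 p. 22; §4.8 p. 23 (arXiv chunk p0015:L97–L104)] -/
theorem semilocal_weakTrace_iff_of (P : Finset ℕ) {k : ℝ → ℂ} (hk : Integrable k) (α β C : ℝ) :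
    (∀ (n : ℕ) (ξ : Fin n → Lp ℂ 2 (volume : Measure ℝ)),
        Orthonormal ℂ ξ → (∀ i, ξ i ∈ semilocalSoninSpaceOf P α β) →
          ∑ i, (soninTraceForm k (ξ i : ℝ → ℂ)).re ≤ C) ↔
    (∀ (n : ℕ) (ζ : Fin n → Lp ℂ 2 (volume : Measure ℝ)),
        Orthonormal ℂ (fun i => twistProd P (ζ i)) → (∀ i, ζ i ∈ soninSpace α β) →
          ∑ i, (soninTraceForm (twistKernelProd P k) (ζ i : ℝ → ℂ)).re ≤ C) := by
  constructor
  · intro h n ζ hON hmem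
    have h' := h n (fun i => twistProd P (ζ i)) hON
      (fun i => twistProd_mem_semilocalSoninSpaceOf P (hmem i))
    simpa only [soninTraceForm_twistProd P hk] using h'
  · intro h n ξ hON hmem
    choose ζ hζ hξ using fun i => mem_semilocalSoninSpaceOf_iff.1 (hmem i)
    have hξ' : (fun i => twistProd P (ζ i)) = ξ := funext hξ
    have h' := h n ζ (hξ' ▸ hON) hζ
    have hsum : ∀ i, (soninTraceForm (twistKernelProd P k) (ζ i : ℝ → ℂ)).re =
        (soninTraceForm k (ξ i : ℝ → ℂ)).re := fun i => by
      rw [← soninTraceForm_twistProd P hk, hξ i]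
    simpa only [hsum] using h'

end TwistedInnerProduct

/-! ## Prop. 4.2 (ii), general `S`: `𝔽_S` is an involution of `L²(ℝ)_ev` (the grading of the even cyclic pair) -/

section Grading

/-- `θ_S` preserves `L²(ℝ)_ev`. [cite: ConnesConsaniMoscovici2024, §4.6 Lemma after Def. 4.5 p. 21 (arXiv chunk p0014:L86)] -/
theorem twistProd_mem_evenPart (P : Finset ℕ) {ξ : Lp ℂ 2 (volume : Measure ℝ)} (hξ : ξ ∈ evenPart) :
    twistProd P ξ ∈ evenPart :=
  twistProd_mem_of_mem (fun q hq ξ h => @one_sub_primeTwist_mem_evenPart q ⟨hq⟩ ξ h) P hξ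

/-- `θ_S⁻¹` preserves `L²(ℝ)_ev`. [cite: ConnesConsaniMoscovici2024, Thm. 4.6 §4.7 p. 22 (arXiv chunk p0015:L88)] -/
theorem twistInvProd_mem_evenPart (P : Finset ℕ) {ξ : Lp ℂ 2 (volume : Measure ℝ)} (hξ : ξ ∈ evenPart) :
    twistInvProd P ξ ∈ evenPart :=
  twistInvProd_mem_of_mem isClosed_evenPart (fun q hq ξ h => @one_sub_primeTwist_mem_evenPart q ⟨hq⟩ ξ h) P hξ

/-- **`𝔽_S` preserves `L²(ℝ)_ev`** (it is an operator of the `K_S`-invariant part `L²(X_S)^{K_S} ≅ L²(ℝ)_ev`).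
[cite: ConnesConsaniMoscovici2024, Prop. 4.2 (ii) §4.2 p. 18 (arXiv chunk p0013:L5)] -/
theorem semilocalFourierOf_mem_evenPart (P : Finset ℕ) {ξ : Lp ℂ 2 (volume : Measure ℝ)} (hξ : ξ ∈ evenPart) :
    semilocalFourierOf P ξ ∈ evenPart := by
  rw [semilocalFourierOf_apply]
  exact twistProd_mem_evenPart P (fourier_mem_evenPart (twistInvProd_mem_evenPart P hξ))

/-- **Prop. 4.2 (ii), general `S`: `𝔽_S` is an involution on `L²(ℝ)_ev`** — "the grading is given by the
Fourier transform `𝔽_S`": `𝔽_S(𝔽_S ξ) = ξ` for every even `ξ` (`𝔽_S² = θ_S 𝓕² θ_S⁻¹` and `𝓕² = 1` on even functions,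
the tree's `fourier_fourier_of_mem_evenPart`).  Together with `semilocalFourierOf_mem_unitary` (`𝔽_S` unitary,
`SemilocalTransformGeneralS.lean`), `𝔽_S` is a self-adjoint unitary grading of `L²(X_S)^{K_S}`, as a grading must be.
PROVED.  RH-FREE. [cite: ConnesConsaniMoscovici2024, Prop. 4.2 (ii) §4.2 p. 18 (arXiv chunk p0013:L5, proof L17)] -/
theorem semilocalFourierOf_semilocalFourierOf_of_mem_evenPart (P : Finset ℕ) {ξ : Lp ℂ 2 (volume : Measure ℝ)}
    (hξ : ξ ∈ evenPart) : semilocalFourierOf P (semilocalFourierOf P ξ) = ξ := by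
  have hη : twistInvProd P ξ ∈ evenPart := twistInvProd_mem_evenPart P hξ
  have h1 : twistInvProd P (twistProd P ((𝓕 (twistInvProd P ξ) : Lp ℂ 2 (volume : Measure ℝ)))) =
      (𝓕 (twistInvProd P ξ) : Lp ℂ 2 (volume : Measure ℝ)) :=
    congrArg (fun T : Lp ℂ 2 (volume : Measure ℝ) →L[ℂ] Lp ℂ 2 (volume : Measure ℝ) =>
      T (𝓕 (twistInvProd P ξ) : Lp ℂ 2 (volume : Measure ℝ))) (twistInvProd_mul_twistProd P)
  have h2 : twistProd P (twistInvProd P ξ) = ξ :=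
    congrArg (fun T : Lp ℂ 2 (volume : Measure ℝ) →L[ℂ] Lp ℂ 2 (volume : Measure ℝ) => T ξ)
      (twistProd_mul_twistInvProd P)
  rw [semilocalFourierOf_apply, semilocalFourierOf_apply, h1, fourier_fourier_of_mem_evenPart hη, h2]

/-- On even vectors `𝔽_S⁻¹ = 𝔽_S` (and `= 𝔽_S^*` by `adjoint_semilocalFourierOf`): the grading is a symmetry.
[cite: ConnesConsaniMoscovici2024, Prop. 4.2 (ii) §4.2 p. 18 (arXiv chunk p0013:L5)] -/
theorem semilocalFourierInvOf_eq_of_mem_evenPart (P : Finset ℕ) {ξ : Lp ℂ 2 (volume : Measure ℝ)}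
    (hξ : ξ ∈ evenPart) : semilocalFourierInvOf P ξ = semilocalFourierOf P ξ := by
  have h : semilocalFourierInvOf P (semilocalFourierOf P (semilocalFourierOf P ξ)) = semilocalFourierOf P ξ :=
    congrArg (fun T : Lp ℂ 2 (volume : Measure ℝ) →L[ℂ] Lp ℂ 2 (volume : Measure ℝ) =>
      T (semilocalFourierOf P ξ)) (semilocalFourierInvOf_mul P)
  rw [semilocalFourierOf_semilocalFourierOf_of_mem_evenPart P hξ] at h
  exact h

end Grading

end Literature.NumberTheory.ConnesConsani2024
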